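import Literature.MathematicalPhysics.QuantumFieldTheory.Balaban1983to89.B12Eq311CurrentExpansion
import Literature.MathematicalPhysics.QuantumFieldTheory.Balaban1983to89.B9Eq373V3

/-!
# `Balaban1983to89.B12Eq311Locality` — T. Bałaban, *Renormalization group approach to lattice gauge field theories. I*,
Commun. Math. Phys. **109** (1987) 249–301 [Balaban1987RG1]: **(3.11) «𝐅 is a local operator» — the set-level locality of the
current (1.8) and of the remainder `𝐅(U, 𝐀)` of (3.11)**: the value at a bond `b = (μ, x)` of `J(V) = D^{ξ*}_V ξ⁻²π Im ∂V`, of the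
first-order term `D^{ξ*}_V π D^ξ_V 𝐀` and of `𝐅(V, 𝐀)` depends only on the restriction of `(V, 𝐀)` to the bonds of the `2(d − 1)`
plaquettes containing `b` — the set `st(b)` of [15] p. 404, IN THE TREE as `B9Eq372Locality.stBonds` (reused by name, not
re-declared; likewise `B9Eq373V3.plaqU_congr_cfg`).  Companion of `B12Eq311CurrentExpansion` (the objects) and `B12Eq311RemainderBound`
(the bound «depending on U, ∂U, 𝐀, ∇^ξ_U𝐀 only»).

HONEST FRAMING (cell `lit-balaban`, verbatim): statement-level skeleton of published theorems with citation tags; proofs where landed; nothing here is a claim about the Yang–Mills mass gap.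

PDF held: `paper:balaban1987-cmp109-rg-i-small-field` (journal page = PDF page + 248); p. 261 ((1.8)) and p. 272 ((3.11)) re-read by this unit.

THE PRINT, verbatim (p. 272): *«D^{ξ*}_{exp iξ𝐀U} ξ⁻²π Im ∂ exp iξ𝐀U = D^{ξ*}_U ξ⁻²π Im ∂U + D^{ξ*}_U D^ξ_U 𝐀 + 𝐅(U, 𝐀), (3.11) where 𝐅 is
a local operator depending on U, ∂U, 𝐀, ∇^ξ_U𝐀 only.»*  On the abstract lattice of [15] §3 (`T : ι → S ≃ S` the unit translations,
carrier `B9Eq39Adjoint`) the current at `(μ, x)` is `ξ⁻¹[Σ_{ν<μ} D*_ν G_{νμ}(x) − Σ_{ν>μ} D*_ν G_{μν}(x)]` with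
`D*_ν G(x) = R(V_ν(x − e_ν))⁻¹ G(x − e_ν) − G(x)` ((3.9) [15]) and `G = ξ⁻²π Im V(∂p)`; the plaquette `p_{κλ}(y)` has the bonds
`(κ, y), (λ, y + e_κ), (κ, y + e_λ), (λ, y)`.  Hence the bonds seen from `(μ, x)`: for every `ν ≠ μ`, `(μ, x)`, `(ν, x)`,
`(ν, x + e_μ)`, `(μ, x + e_ν)`, `(μ, x − e_ν)`, `(ν, x − e_ν)`, `(ν, x − e_ν + e_μ)` = `stBonds T μ x = ⋃_{ν ≠ μ} (∂p_{νμ}(x) ∪ ∂p_{νμ}(x − e_ν))`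
(no commuting of the translations is used).

THEOREMS ONLY (no definition, no `Prop` placeholder, no new fact; axioms standard): `curl_congr`, `prodCfg_congr`, `divP_congr` (the
divergence (3.9) [15] at `b` sees the transports `V_ν(x − e_ν)` and the plaquette function on the plaquettes through `b`), `Jπ_congr` (the
current (1.8) at `b` depends on `V` on `stBonds b`), `lapπ_congr`, **`F311_congr`** (`𝐅(V, 𝐀)(b)` depends on `(V, 𝐀)` on `stBonds b`), and on
the torus `current_congr` / **`rem311_congr`** for `B12Eq18Current.current` / `B12Eq311CurrentExpansion.rem311`.
Unit `lit-balaban-p07` (Phase-2 seat p07 gen 7; row B12.Eq3.10-3.12, owners r09/r20), HOME `run/shared/lean/pub/lit-balaban/`.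
-/

open NormedSpace Complex

namespace Literature.MathematicalPhysics.QuantumFieldTheory.Balaban1983to89.B12Eq311Locality

open Literature.MathematicalPhysics.QuantumFieldTheory.Balaban1983to89
open Literature.MathematicalPhysics.QuantumFieldTheory.Balaban1983to89.B9Eq37Insertion
open Literature.MathematicalPhysics.QuantumFieldTheory.Balaban1983to89.B9Eq39Adjoint
open Literature.MathematicalPhysics.QuantumFieldTheory.Balaban1983to89.B9TorusCalculus
open Literature.MathematicalPhysics.QuantumFieldTheory.Balaban1983to89.B9Eq372Locality
open Literature.MathematicalPhysics.QuantumFieldTheory.Balaban1983to89.B9Eq373V3 (plaqU_congr_cfg)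
open Literature.MathematicalPhysics.QuantumFieldTheory.Balaban1983to89.B12Eq311CurrentExpansion

noncomputable section

/-! ## §1. Locality on the abstract lattice (the set `st(b)` = `B9Eq372Locality.stBonds`) -/

section Abstract

variable {𝔸 : Type*} [NormedRing 𝔸] {S : Type*} {ι : Type*} (T : ι → Equiv.Perm S)

/-- The curl `D¹_V𝐀(p_{κλ}(y))` depends on `V` at `(κ, y), (λ, y)` and on `𝐀` on the four bonds of the plaquette.
[cite: Balaban1985BackgroundPropagators, (3.3) p.390] -/
theorem curl_congr {V V' : ι → S → 𝔸ˣ} {A A' : ι → S → 𝔸} {κ ν : ι} {y : S} (h₁ : V κ y = V' κ y) (h₄ : V ν y = V' ν y)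
    (a₁ : A κ y = A' κ y) (a₂ : A ν (T κ y) = A' ν (T κ y)) (a₃ : A κ (T ν y) = A' κ (T ν y)) (a₄ : A ν y = A' ν y) :
    curl T V A κ ν y = curl T V' A' κ ν y := by
  simp only [curl, covD, h₁, h₄, a₁, a₂, a₃, a₄]

/-- From agreement on `st(b)`, `b = (μ, x)`: the eight bond equalities for a direction `ν ≠ μ` (the bonds of `p_{νμ}(x)` and of
`p_{νμ}(x − e_ν)`). [cite: Balaban1985BackgroundPropagators, p.404 after (3.69)] -/
private theorem star_eqs {M : Type*} {W W' : ι → S → M} {μ : ι} {x : S}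
    (h : ∀ κ y, (κ, y) ∈ stBonds T μ x → W κ y = W' κ y) {ν : ι} (hν : ν ≠ μ) :
    (W μ x = W' μ x ∧ W ν x = W' ν x ∧ W ν (T μ x) = W' ν (T μ x) ∧ W μ (T ν x) = W' μ (T ν x)) ∧
      (W μ ((T ν).symm x) = W' μ ((T ν).symm x) ∧ W ν ((T ν).symm x) = W' ν ((T ν).symm x) ∧
      W ν (T μ ((T ν).symm x)) = W' ν (T μ ((T ν).symm x)) ∧ W μ (T ν ((T ν).symm x)) = W' μ (T ν ((T ν).symm x))) := by
  have m : ∀ y κ z, (κ, z) ∈ pBonds T ν μ y → (y = x ∨ y = (T ν).symm x) → W κ z = W' κ z := fun y κ z hq hy =>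
    h κ z (mem_stBonds_of_mem hν (by rcases hy with rfl | rfl; exacts [Or.inl hq, Or.inr hq]))
  have q : ∀ y, (μ, y) ∈ pBonds T ν μ y ∧ (ν, y) ∈ pBonds T ν μ y ∧ (ν, T μ y) ∈ pBonds T ν μ y ∧ (μ, T ν y) ∈ pBonds T ν μ y :=
    fun y => by simp [pBonds]
  exact ⟨⟨m x _ _ (q x).1 (Or.inl rfl), m x _ _ (q x).2.1 (Or.inl rfl), m x _ _ (q x).2.2.1 (Or.inl rfl), m x _ _ (q x).2.2.2 (Or.inl rfl)⟩,
    ⟨m _ _ _ (q _).1 (Or.inr rfl), m _ _ _ (q _).2.1 (Or.inr rfl), m _ _ _ (q _).2.2.1 (Or.inr rfl), m _ _ _ (q _).2.2.2 (Or.inr rfl)⟩⟩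

/-- The plaquette variables seen from `(μ, x)` agree when the configurations agree on `st(b)` (`B9Eq373V3.plaqU_congr_cfg` on the
four plaquette slots of the divergence). [cite: Balaban1985BackgroundPropagators, (3.4) p.391, p.404 after (3.69)] -/
private theorem plaq_eqs {V V' : ι → S → 𝔸ˣ} {μ : ι} {x : S}
    (hV : ∀ κ y, (κ, y) ∈ stBonds T μ x → V κ y = V' κ y) {ν : ι} (hν : ν ≠ μ) :
    plaqU T V ν μ x = plaqU T V' ν μ x ∧ plaqU T V μ ν x = plaqU T V' μ ν x ∧
      plaqU T V ν μ ((T ν).symm x) = plaqU T V' ν μ ((T ν).symm x) ∧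
      plaqU T V μ ν ((T ν).symm x) = plaqU T V' μ ν ((T ν).symm x) := by
  obtain ⟨⟨e₁, e₂, e₃, e₄⟩, e₅, e₆, e₇, e₈⟩ := star_eqs T hV hν
  exact ⟨plaqU_congr_cfg T e₂ e₄ e₃ e₁, plaqU_congr_cfg T e₁ e₃ e₄ e₂, plaqU_congr_cfg T e₆ e₈ e₇ e₅,
    plaqU_congr_cfg T e₅ e₇ e₈ e₆⟩

variable [Fintype ι] [LinearOrder ι]

/-- The divergence (3.9) [15] at `(μ, x)` depends on the transports `V_ν(x − e_ν)`, `ν ≠ μ`, and on the plaquette function at the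
plaquettes `p_{μν}(x)`, `p_{μν}(x − e_ν)` (both orientations). [cite: Balaban1985BackgroundPropagators, (3.9) p.392] -/
theorem divP_congr {V V' : ι → S → 𝔸ˣ} {F F' : ι → ι → S → 𝔸} {μ : ι} {x : S}
    (hV : ∀ ν, ν ≠ μ → V ν ((T ν).symm x) = V' ν ((T ν).symm x))
    (hF : ∀ ν, ν ≠ μ → F ν μ x = F' ν μ x ∧ F μ ν x = F' μ ν x ∧
      F ν μ ((T ν).symm x) = F' ν μ ((T ν).symm x) ∧ F μ ν ((T ν).symm x) = F' μ ν ((T ν).symm x)) :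
    divP T V F μ x = divP T V' F' μ x := by
  unfold divP
  congr 1
  · refine Finset.sum_congr rfl fun ν _ => ?_
    split_ifs with h
    · obtain ⟨h1, -, h3, -⟩ := hF ν h.ne
      simp only [covDstar, hV ν h.ne, h1, h3]
    · rfl
  · refine Finset.sum_congr rfl fun ν _ => ?_
    split_ifs with h
    · obtain ⟨-, h2, -, h4⟩ := hF ν h.ne'
      simp only [covDstar, hV ν h.ne', h2, h4]
    · rfl

variable [NormedAlgebra ℂ 𝔸]

/-- **The current (1.8) is local**: `J(V)(b)` depends only on `V` on the bonds of the plaquettes through `b`.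
[cite: Balaban1987RG1, (1.8) p.261, (3.11) p.272] -/
theorem Jπ_congr (π : 𝔸 →ₗ[ℂ] 𝔸) (ξ : ℝ) {V V' : ι → S → 𝔸ˣ} {μ : ι} {x : S}
    (hV : ∀ κ y, (κ, y) ∈ stBonds T μ x → V κ y = V' κ y) : Jπ T π ξ V μ x = Jπ T π ξ V' μ x := by
  simp only [Jπ, divPη]
  congr 1
  refine divP_congr T (fun ν hν => (star_eqs T hV hν).2.2.1) fun ν hν => ?_
  obtain ⟨p₁, p₂, p₃, p₄⟩ := plaq_eqs T hV hν
  simp only [Gπ, p₁, p₂, p₃, p₄, and_self]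

/-- **The first-order term `D^{ξ*}_V π D^ξ_V 𝐀` of (3.11) is local**: its value at `b` depends only on `(V, 𝐀)` on `stBonds b`.
[cite: Balaban1987RG1, (3.11) p.272] -/
theorem lapπ_congr (π : 𝔸 →ₗ[ℂ] 𝔸) (ξ : ℝ) {V V' : ι → S → 𝔸ˣ} {A A' : ι → S → 𝔸} {μ : ι} {x : S}
    (hV : ∀ κ y, (κ, y) ∈ stBonds T μ x → V κ y = V' κ y) (hA : ∀ κ y, (κ, y) ∈ stBonds T μ x → A κ y = A' κ y) :
    lapπ T π ξ V A μ x = lapπ T π ξ V' A' μ x := by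
  simp only [lapπ, divPη]
  congr 1
  refine divP_congr T (fun ν hν => (star_eqs T hV hν).2.2.1) fun ν hν => ?_
  obtain ⟨⟨e₁, e₂, -, -⟩, e₅, e₆, -, -⟩ := star_eqs T hV hν
  obtain ⟨⟨a₁, a₂, a₃, a₄⟩, a₅, a₆, a₇, a₈⟩ := star_eqs T hA hν
  simp only [curlη, curl_congr T e₂ e₁ a₂ a₄ a₃ a₁, curl_congr T e₁ e₂ a₁ a₃ a₄ a₂, curl_congr T e₆ e₅ a₆ a₈ a₇ a₅,
    curl_congr T e₅ e₆ a₅ a₇ a₈ a₆, and_self]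

variable [CompleteSpace 𝔸]

omit [Fintype ι] [LinearOrder ι] in
/-- The fluctuation configuration `e^{iξ𝐀}V` at a bond depends on `(V, 𝐀)` at that bond. [cite: Balaban1987RG1, (3.10) p.272] -/
theorem prodCfg_congr {V V' : ι → S → 𝔸ˣ} {A A' : ι → S → 𝔸} {ξ : ℝ} {κ : ι} {y : S} (hV : V κ y = V' κ y)
    (hA : A κ y = A' κ y) : prodCfg V ξ A κ y = prodCfg V' ξ A' κ y := by
  simp only [prodCfg, fluct, hV, hA]

/-- **[B12 (3.11)] «𝐅 is a local operator»**: the remainder `𝐅(V, 𝐀)(b)` of (3.11) depends only on the restriction of `(V, 𝐀)` to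
the bonds of the `2(d − 1)` plaquettes through `b` (`stBonds b`). [cite: Balaban1987RG1, (3.11) p.272] -/
theorem F311_congr (π : 𝔸 →ₗ[ℂ] 𝔸) (ξ : ℝ) {V V' : ι → S → 𝔸ˣ} {A A' : ι → S → 𝔸} {μ : ι} {x : S}
    (hV : ∀ κ y, (κ, y) ∈ stBonds T μ x → V κ y = V' κ y) (hA : ∀ κ y, (κ, y) ∈ stBonds T μ x → A κ y = A' κ y) :
    F311 T π ξ V A μ x = F311 T π ξ V' A' μ x := by
  have hW : ∀ κ y, (κ, y) ∈ stBonds T μ x → prodCfg V ξ A κ y = prodCfg V' ξ A' κ y :=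
    fun κ y h => prodCfg_congr (hV κ y h) (hA κ y h)
  simp only [F311, Jπ_congr T π ξ hW, Jπ_congr T π ξ hV, lapπ_congr T π ξ hV hA]

end Abstract

/-! ## §2. On the torus -/

section Torus

variable {P : Params} {i : ℕ} {𝔸 : Type*} [NormedRing 𝔸] [NormedAlgebra ℂ 𝔸]

/-- **The current (1.8) on the torus is local**: `J(U)(b)` depends only on `U` on the bonds `b' = (y, κ)` with
`(κ, y) ∈ stBonds b` (the plaquettes through `b`). [cite: Balaban1987RG1, (1.8) p.261] -/
theorem current_congr (π : 𝔸 →ₗ[ℂ] 𝔸) (ξ : ℝ) {U U' : PBond P i → 𝔸ˣ} {b : PBond P i}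
    (hU : ∀ b' : PBond P i, (b'.dir, b'.src) ∈ stBonds (torusT P i) b.dir b.src → U b' = U' b') :
    B12Eq18Current.current π ξ U b = B12Eq18Current.current π ξ U' b := by
  rw [current_eq_Jπ, current_eq_Jπ]
  exact Jπ_congr (torusT P i) π ξ fun κ y h => hU ⟨y, κ⟩ h

variable [CompleteSpace 𝔸]

/-- **[B12 (3.11)] «𝐅 is a local operator», on the torus**: `𝐅(U, 𝐀)(b)` (`B12Eq311CurrentExpansion.rem311`) depends only on
`(U, 𝐀)` on the bonds of the plaquettes through `b`. [cite: Balaban1987RG1, (3.11) p.272] -/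
theorem rem311_congr (π : 𝔸 →ₗ[ℂ] 𝔸) (ξ : ℝ) {U U' : PBond P i → 𝔸ˣ} {A A' : PBond P i → 𝔸} {b : PBond P i}
    (hU : ∀ b' : PBond P i, (b'.dir, b'.src) ∈ stBonds (torusT P i) b.dir b.src → U b' = U' b')
    (hA : ∀ b' : PBond P i, (b'.dir, b'.src) ∈ stBonds (torusT P i) b.dir b.src → A b' = A' b') :
    rem311 π ξ U A b = rem311 π ξ U' A' b :=
  F311_congr (torusT P i) π ξ (fun κ y h => hU ⟨y, κ⟩ h) fun κ y h => hA ⟨y, κ⟩ h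

end Torus

end

end Literature.MathematicalPhysics.QuantumFieldTheory.Balaban1983to89.B12Eq311Locality
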